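import Literature.NumberTheory.GaloisRepresentations.FrobeniusQuotientHOne
import Literature.NumberTheory.GaloisRepresentations.FiniteCoefficientsTorsion
import Literature.AnabelianGeometry.AbsoluteAnabelian.FreeProcyclicCdOne
import HarnessLib

/-!
# Cohomology of a free procyclic group: `#H¹(G, B) = #B^G` for finite `B`, `H²(G, A) = 0` for
# torsion `A`, and the cuspidal inertia groups `I_x ≅ Ẑ(1)`

abc-iut cell, layer L4.  PROOF file (no definition, no named fact).  Companion of
`FreeProcyclicCdOne.lean` (`H²(G, B) = 0` for finite `B`, `cd_p(G) ≤ 1`): for a profinite group `G`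
with a dense cyclic subgroup `γ^ℤ` and an open subgroup of every positive index — the cell's
`FundamentalExtension.IsFreeProcyclic G`, "`G ≅ Ẑ`" ([AbsTopI] §0 p. 7; [AbsTopIII] Prop. 1.4 (i)
p. 31 `I_x ≅ Ẑ(1)`) — and a discrete `G`-module with arbitrary continuous action,

* `subsingleton_continuousCohomology_two_of_isTorsion_of_dense_zpowers` /
  `FundamentalExtension.IsFreeProcyclic.subsingleton_continuousCohomology_two_of_isTorsion` —
  **`H²(G, A) = 0` for every TORSION discrete `G`-module `A`** (the finite case of
  `FreeProcyclicCdOne` + the torsion reduction `subsingleton_of_forall_finite_of_isTorsion`);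
* `exists_openNormal_invariant` — a continuous crossed homomorphism on a profinite group with values
  in a finite discrete module is right-invariant under an open normal subgroup acting trivially;
* `natCard_continuousCohomology_one_of_finite_of_dense_zpowers` /
  `FundamentalExtension.IsFreeProcyclic.natCard_continuousCohomology_one_of_finite` —
  **`#H¹(G, B) = #B^G`** (`H¹(G, B) ≅ B/(γ - 1)B` via `[z] ↦ z(γ)`, and `#ker(γ - 1) = #coker(γ - 1)`);
* `natCard_continuousCohomology_one_zHatCompletion` — the case of Mathlib's `Ẑ`;
* `FundamentalExtension.CuspidalData.subsingleton_continuousCohomology_two_Icusp` /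
  `groupCdLE_one_Icusp` / `natCard_continuousCohomology_one_Icusp` — the cases of the cuspidal inertia
  groups `I_x ≅ Ẑ(1)` of an extension with `InertiaFreeProcyclic` ([AbsTopIII] Prop. 1.4 (i)).

This is the generic form of the tree's `natCard_continuousCohomology_one_quotient_galUnr`
(`FrobeniusQuotientHOne.lean`, the case `G = Gal(F^nr/F)`, `γ` = Frobenius; Serre, *Local Fields*
XIII §1 Prop. 1; Milne, *ADT* I §2, proof of Lemma 2.9): the same argument with the Frobenius replaced
by the dense generator `γ` and the unramified extension of degree `m` by an open subgroup of index `m`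
(every finite quotient of `G` is cyclic on `γ̄`, `exists_pow_eq_mk_of_dense_zpowers` of
`FreeProcyclicCdOne.lean`; the cocycle with prescribed value at `γ` is the tree's `geomCocycle`).
HONEST FRAMING: classical; nothing here bears on [IUTchIII] Cor. 3.12 or takes a side.
-/

noncomputable section

open CategoryTheory Function
open ProfiniteGrp ProfiniteGrp.ProfiniteCompletion

universe u

namespace Literature.AnabelianGeometry.AbsoluteAnabelian

open Literature.NumberTheory.GaloisRepresentations
open _root_.TopRep _root_.ContRepresentation _root_.ContinuousCohomology _root_.Topology _root_.Filter

section DenseGenerator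

variable {G : Type u} [Group G] [TopologicalSpace G] [IsTopologicalGroup G] [CompactSpace G]
  [TotallyDisconnectedSpace G]
variable {B : Type u} [AddCommGroup B] [TopologicalSpace B] [DiscreteTopology B]

/-- **A continuous crossed homomorphism on a profinite group with values in a finite discrete module
is right-invariant under an open normal subgroup acting trivially** (uniform local constancy).
[cite: SerreLocalFields1979, XIII §1 Prop. 1] -/
theorem exists_openNormal_invariant [Finite B] (τ : ContinuousRep G ℤ B)
    (w : contOneCocycles τ.toTopRep) :
    ∃ H₀ : Subgroup G, H₀.Normal ∧ IsOpen (H₀ : Set G) ∧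
      (∀ h ∈ H₀, ∀ b : B, τ h b = b) ∧ ∀ σ, ∀ h ∈ H₀, w.1 (σ * h) = w.1 σ := by
  have hker : (⋂ b : B, {σ : G | τ σ b = b}) ∈ 𝓝 (1 : G) :=
    (Filter.iInter_mem).2 fun b => τ.setOf_apply_eq_mem_nhds_one b
  obtain ⟨V, hV, hVw⟩ := exists_nhds_one_forall_eq' (X := G) (P := G)
    (fun a v => w.1 (a * v)) (w.1.continuous.comp continuous_mul)
  have h1 : (1 : G) ∈ interior ((⋂ b : B, {σ : G | τ σ b = b}) ∩ V) :=
    mem_interior_iff_mem_nhds.2 (inter_mem hker hV)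
  obtain ⟨W, hW⟩ := ProfiniteGrp.exist_openNormalSubgroup_sub_open_nhds_of_one isOpen_interior h1
  have hW' : (W : Set G) ⊆ (⋂ b : B, {σ | τ σ b = b}) ∩ V := hW.trans interior_subset
  refine ⟨W, inferInstance, W.isOpen', fun h hh b => Set.mem_iInter.1 (hW' hh).1 b, fun σ h hh => ?_⟩
  have e := hVw σ h (hW' hh).2
  change w.1 (σ * h) = w.1 (σ * 1) at e
  rwa [mul_one] at e

/-- **`H²(G, A) = 0` for `G ≅ Ẑ` (dense generator `γ`, an open subgroup of every positive index)
and every TORSION discrete `G`-module `A`** ("`cd(Ẑ) ≤ 1`" in its usual form).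
[cite: SerreGaloisCohomology1997, II §4.3 Prop. 12] -/
theorem subsingleton_continuousCohomology_two_of_isTorsion_of_dense_zpowers [T2Space G] {γ : G}
    (hγ : Dense (Subgroup.zpowers γ : Set G))
    (hidx : ∀ n : ℕ, 0 < n → ∃ H : Subgroup G, IsOpen (H : Set G) ∧ H.index = n)
    (A : Type u) [AddCommGroup A] [TopologicalSpace A] [DiscreteTopology A] (hA : AddMonoid.IsTorsion A)
    (ρ : ContinuousRep G ℤ A) : Subsingleton (continuousCohomology 2 ρ.toTopRep) :=
  subsingleton_of_forall_finite_of_isTorsion ρ 1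
    (fun B _ _ _ _ τ => subsingleton_continuousCohomology_two_of_finite_of_dense_zpowers hγ hidx B τ) hA

/-- **`H²(G, A) = 0` for a free procyclic profinite group `G` and every torsion discrete `G`-module
`A`.** [cite: SerreGaloisCohomology1997, II §4.3 Prop. 12] -/
theorem FundamentalExtension.IsFreeProcyclic.subsingleton_continuousCohomology_two_of_isTorsion
    [T2Space G] (h : FundamentalExtension.IsFreeProcyclic G)
    (A : Type u) [AddCommGroup A] [TopologicalSpace A] [DiscreteTopology A] (hA : AddMonoid.IsTorsion A)
    (ρ : ContinuousRep G ℤ A) : Subsingleton (continuousCohomology 2 ρ.toTopRep) := by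
  obtain ⟨γ, hγ⟩ := h.exists_dense_zpowers
  exact subsingleton_continuousCohomology_two_of_isTorsion_of_dense_zpowers hγ h.exists_isOpen_index A hA ρ

/-- **`#H¹(G, B) = #B^G` for `G ≅ Ẑ` topologically generated by `γ` and a finite discrete
`G`-module `B`** (`G` profinite with a dense cyclic subgroup and an open subgroup of every positive
index): `B^G = ker(γ - 1)`, `H¹(G, B) ≅ B/(γ - 1)B` via `[z] ↦ z(γ)` (injective because a cocycle
inflated from a finite cyclic quotient vanishing at the generator vanishes; surjective by the geometric
cocycle `σ ↦ Σ_{j<idx σ} γʲ b₀` at the open normal level where the norm of `b₀` dies), and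
`#ker = #coker` for an endomorphism of a finite group. [cite: SerreLocalFields1979, XIII §1 Prop. 1] -/
theorem natCard_continuousCohomology_one_of_finite_of_dense_zpowers {γ : G}
    (hγ : Dense (Subgroup.zpowers γ : Set G))
    (hidx : ∀ n : ℕ, 0 < n → ∃ H : Subgroup G, IsOpen (H : Set G) ∧ H.index = n)
    (B : Type u) [AddCommGroup B] [TopologicalSpace B] [DiscreteTopology B] [Finite B]
    (τ : ContinuousRep G ℤ B) :
    Nat.card (continuousCohomology 1 τ.toTopRep) = Nat.card τ.toTopRep.ρ.invariants := by
  classical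
  have hgen : ∀ (H : Subgroup G) [H.Normal], IsOpen (H : Set G) →
      ∀ r : G ⧸ H, ∃ i : ℕ, r = (QuotientGroup.mk γ : G ⧸ H) ^ i :=
    fun H _ hH r => exists_pow_eq_mk_of_dense_zpowers hγ H hH r
  let T : B →ₗ[ℤ] B := τ γ
  let δ : B →+ B := (T - 1 : B →ₗ[ℤ] B).toAddMonoidHom
  have hδ : ∀ b, δ b = T b - b := fun _ => rfl
  -- an open normal subgroup acting trivially (from the zero cocycle)
  obtain ⟨H₀, hH₀n, hH₀o, hH₀X, -⟩ := exists_openNormal_invariant τ 0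
  haveI := hH₀n
  haveI : Finite (G ⧸ H₀) := Subgroup.quotient_finite_of_isOpen H₀ hH₀o
  -- (1) invariants `= ker (T - 1)`
  have hinv : ∀ b : B, (∀ q : G, τ q b = b) ↔ δ b = 0 := fun b => by
    refine ⟨fun h => by rw [hδ, sub_eq_zero]; exact h γ, fun h q => ?_⟩
    rw [hδ, sub_eq_zero] at h
    have hpow : ∀ i : ℕ, τ (γ ^ i) b = b := fun i => by
      induction i with
      | zero => rw [pow_zero, map_one, Module.End.one_apply]
      | succ i ih => rw [pow_succ, map_mul, Module.End.mul_apply, h, ih]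
    obtain ⟨i, hi⟩ := hgen H₀ hH₀o (QuotientGroup.mk q)
    rw [← QuotientGroup.mk_pow, QuotientGroup.eq] at hi
    rw [show q = γ ^ i * (q⁻¹ * γ ^ i)⁻¹ by rw [mul_inv_rev, inv_inv, mul_inv_cancel_left], map_mul,
      Module.End.mul_apply, hH₀X _ (H₀.inv_mem hi), hpow]
  have e_inv : τ.toTopRep.ρ.invariants ≃ δ.ker :=
    { toFun := fun v => ⟨v.1, (hinv v.1).1 fun q => v.2 q⟩
      invFun := fun v => ⟨v.1, fun q => (hinv v.1).2 v.2 q⟩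
      left_inv := fun _ => rfl
      right_inv := fun _ => rfl }
  -- (2) `#(B / im δ) = #ker δ`
  have hcount : Nat.card (B ⧸ δ.range) = Nat.card δ.ker := by
    have h1 := AddSubgroup.card_eq_card_quotient_mul_card_addSubgroup δ.range
    have h2 := AddSubgroup.card_eq_card_quotient_mul_card_addSubgroup δ.ker
    rw [Nat.card_congr (QuotientAddGroup.quotientKerEquivRange δ).toEquiv] at h2
    have hpos : 0 < Nat.card δ.range := Nat.card_pos
    rw [h2, mul_comm] at h1
    exact (Nat.eq_of_mul_eq_mul_right hpos h1).symm
  -- (3) `H¹ ≃ B / im δ`, `[z] ↦ z(γ)`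
  choose rep hrep using fun c : continuousCohomology 1 τ.toTopRep => oneCocycleClass_surjective _ c
  let f : continuousCohomology 1 τ.toTopRep → B ⧸ δ.range := fun c => QuotientAddGroup.mk ((rep c).1 γ)
  have hf : Bijective f := by
    constructor
    · intro c d hcd
      obtain ⟨b₁, hb₁⟩ : -((rep c).1 γ) + (rep d).1 γ ∈ δ.range := (QuotientAddGroup.eq).1 hcd
      -- the cocycle `rep d - rep c - ∂b₁` vanishes at `γ`, hence everywhere
      set w : contOneCocycles τ.toTopRep := rep d - rep c - coboundaryCocycle τ b₁ with hwdef
      obtain ⟨H, hHn, hHo, -, hHw⟩ := exists_openNormal_invariant τ w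
      haveI := hHn
      have hw0 : w = 0 := by
        refine contOneCocycles.eq_zero_of_apply_eq_zero γ H (hgen H hHo) w hHw ?_
        change (rep d).1 γ - (rep c).1 γ - (τ γ b₁ - b₁) = 0
        rw [← hδ, hb₁]; abel
      have : oneCocycleClass _ (rep d) - oneCocycleClass _ (rep c) = 0 := by
        rw [← oneCocycleClass_sub, show rep d - rep c = w + coboundaryCocycle τ b₁ by rw [hwdef]; abel, hw0,
          zero_add, oneCocycleClass_coboundaryCocycle]
      rw [hrep, hrep, sub_eq_zero] at this
      exact this.symm
    · intro y
      obtain ⟨b₀, rfl⟩ := QuotientAddGroup.mk_surjective y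
      -- the deeper level `H₁ = H₀ ∩ N`, `#B · (G : H₀) ∣ (G : N)`, at which the norm of `b₀` vanishes
      set n₀ : ℕ := orderOf (QuotientGroup.mk γ : G ⧸ H₀) with hn₀
      have hn₀pos : 0 < n₀ := orderOf_pos _
      set m : ℕ := Nat.card B * n₀ with hmdef
      have hm : 0 < m := Nat.mul_pos Nat.card_pos hn₀pos
      obtain ⟨U, hUo, hUi⟩ := hidx m hm
      obtain ⟨N, hNU⟩ := ProfiniteGrp.exist_openNormalSubgroup_sub_open_nhds_of_one hUo U.one_mem
      let H₁ : Subgroup G := H₀ ⊓ (N : Subgroup G)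
      haveI : H₁.Normal := inferInstance
      have hH₁o : IsOpen (H₁ : Set G) := hH₀o.inter N.isOpen'
      have hH₁₀ : H₁ ≤ H₀ := inf_le_left
      have hH₁U : H₁ ≤ U := fun g hg => hNU (inf_le_right (a := H₀) hg)
      haveI : Finite (G ⧸ H₁) := Subgroup.quotient_finite_of_isOpen H₁ hH₁o
      set n₁ : ℕ := orderOf (QuotientGroup.mk γ : G ⧸ H₁) with hn₁
      have hpow₁ : γ ^ n₁ ∈ H₁ := by
        rw [← QuotientGroup.eq_one_iff, QuotientGroup.mk_pow, hn₁]
        exact pow_orderOf_eq_one _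
      -- `γ̄` generates `G ⧸ H₁`, so `n₁ = (G : H₁)` is a multiple of `(G : U) = m`
      have hn₁idx : n₁ = H₁.index := by
        rw [hn₁, Subgroup.index, orderOf_eq_card_of_forall_mem_zpowers]
        intro q
        obtain ⟨i, rfl⟩ := hgen H₁ hH₁o q
        exact Subgroup.pow_mem _ (Subgroup.mem_zpowers _) i
      have hmn₁ : m ∣ n₁ := by
        rw [hn₁idx, ← hUi]
        exact Subgroup.index_dvd_of_le hH₁U
      have hn₀₁ : n₀ ∣ n₁ := by
        rw [hn₀]
        apply orderOf_dvd_of_pow_eq_one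
        rw [← QuotientGroup.mk_pow, QuotientGroup.eq_one_iff]
        exact hH₁₀ hpow₁
      obtain ⟨k, hk⟩ := hn₀₁
      have hNk : Nat.card B ∣ k := by
        have h := hmn₁
        rw [hk, hmdef, mul_comm (Nat.card B) n₀] at h
        exact Nat.dvd_of_mul_dvd_mul_left hn₀pos h
      -- the norm vanishes at level `H₁`
      have hγn₀ : ∀ x : B, τ.toTopRep.ρ (γ ^ n₀) x = x := fun x => by
        rw [ContinuousRep.toTopRep_ρ_apply]
        refine hH₀X _ ?_ x
        rw [← QuotientGroup.eq_one_iff, QuotientGroup.mk_pow, hn₀]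
        exact pow_orderOf_eq_one _
      have hN : geomSum (X := τ.toTopRep) γ b₀ (orderOf (QuotientGroup.mk γ : G ⧸ H₁)) = 0 := by
        rw [← hn₁, hk, geomSum_mul_eq_smul (X := τ.toTopRep) γ b₀ hγn₀ k]
        obtain ⟨k', rfl⟩ := hNk
        rw [mul_comm, mul_nsmul, card_nsmul_eq_zero']
      let z : contOneCocycles τ.toTopRep := geomCocycle γ b₀ H₁ (hgen H₁ hH₁o) hH₁o
        (fun h hh x => by rw [ContinuousRep.toTopRep_ρ_apply]; exact hH₀X h (hH₁₀ hh) x) hN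
      have hz : z.1 γ = b₀ := geomCocycle_apply_self (X := τ.toTopRep) γ b₀ H₁ (hgen H₁ hH₁o) hH₁o _ hN
      refine ⟨oneCocycleClass _ z, ?_⟩
      -- `rep [z] - z` is a coboundary
      have hcob : oneCocycleClass _ (rep (oneCocycleClass _ z) - z) = 0 := by
        rw [oneCocycleClass_sub, hrep, sub_self]
      obtain ⟨v, hv⟩ := (oneCocycleClass_eq_zero_iff _ _).1 hcob
      change QuotientAddGroup.mk ((rep (oneCocycleClass _ z)).1 γ) = QuotientAddGroup.mk b₀
      rw [QuotientAddGroup.eq]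
      refine ⟨-v, ?_⟩
      have h := hv γ
      change (rep (oneCocycleClass _ z)).1 γ - z.1 γ = τ γ v - v at h
      rw [hz] at h
      rw [hδ, map_neg, ← sub_eq_zero, ← sub_eq_zero.2 h]
      abel
  rw [Nat.card_eq_of_bijective f hf, hcount, ← Nat.card_congr e_inv]

/-- **`#H¹(G, B) = #B^G` for a free procyclic profinite group `G` and a finite discrete
`G`-module `B`.** [cite: SerreLocalFields1979, XIII §1 Prop. 1] -/
theorem FundamentalExtension.IsFreeProcyclic.natCard_continuousCohomology_one_of_finite
    (h : FundamentalExtension.IsFreeProcyclic G)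
    (B : Type u) [AddCommGroup B] [TopologicalSpace B] [DiscreteTopology B] [Finite B]
    (τ : ContinuousRep G ℤ B) :
    Nat.card (continuousCohomology 1 τ.toTopRep) = Nat.card τ.toTopRep.ρ.invariants := by
  obtain ⟨γ, hγ⟩ := h.exists_dense_zpowers
  exact natCard_continuousCohomology_one_of_finite_of_dense_zpowers hγ h.exists_isOpen_index B τ

end DenseGenerator

/-- **`#H¹(Ẑ, B) = #B^Ẑ`** for Mathlib's profinite completion `Ẑ` of `ℤ` and a finite discrete
`Ẑ`-module `B`. [cite: SerreLocalFields1979, XIII §1 Prop. 1] -/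
theorem natCard_continuousCohomology_one_zHatCompletion
    (B : Type) [AddCommGroup B] [TopologicalSpace B] [DiscreteTopology B] [Finite B]
    (τ : ContinuousRep (completion (GrpCat.of (Multiplicative ℤ))) ℤ B) :
    Nat.card (continuousCohomology 1 τ.toTopRep) = Nat.card τ.toTopRep.ρ.invariants :=
  isFreeProcyclic_zHatCompletion.natCard_continuousCohomology_one_of_finite B τ

/-! ### Cuspidal inertia groups `I_x ≅ Ẑ(1)` of a `FundamentalExtension` -/

namespace FundamentalExtension.CuspidalData

variable {E : FundamentalExtension.{u}} (C : E.CuspidalData)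

/-- A cuspidal inertia group is compact (closed in the profinite `Π`).
[cite: MochizukiAbsTopIII2015, Prop 1.4 (i) p.31] -/
theorem compactSpace_Icusp (x : C.Cusp) : CompactSpace (C.Icusp x) :=
  isCompact_iff_compactSpace.mp (C.isClosed_Icusp x).isCompact

/-- **`H²(I_x, B) = 0`** for a cuspidal inertia group `I_x ≅ Ẑ(1)` (`InertiaFreeProcyclic`, [AbsTopIII]
Prop. 1.4 (i) "naturally isomorphic to `Ẑ(1)`") and a finite discrete `I_x`-module `B`.
[cite: MochizukiAbsTopIII2015, Prop 1.4 (i) p.31] -/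
theorem subsingleton_continuousCohomology_two_Icusp (hC : InertiaFreeProcyclic C) (x : C.Cusp)
    (B : Type u) [AddCommGroup B] [TopologicalSpace B] [DiscreteTopology B] [Finite B]
    (τ : ContinuousRep (C.Icusp x) ℤ B) : Subsingleton (continuousCohomology 2 τ.toTopRep) := by
  haveI := C.compactSpace_Icusp x
  exact (hC x).subsingleton_continuousCohomology_two_of_finite B τ

/-- **`H²(I_x, A) = 0`** for a cuspidal inertia group `I_x ≅ Ẑ(1)` and a TORSION discrete
`I_x`-module `A`. [cite: MochizukiAbsTopIII2015, Prop 1.4 (i) p.31] -/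
theorem subsingleton_continuousCohomology_two_Icusp_of_isTorsion (hC : InertiaFreeProcyclic C)
    (x : C.Cusp) (A : Type u) [AddCommGroup A] [TopologicalSpace A] [DiscreteTopology A]
    (hA : AddMonoid.IsTorsion A) (τ : ContinuousRep (C.Icusp x) ℤ A) :
    Subsingleton (continuousCohomology 2 τ.toTopRep) := by
  haveI := C.compactSpace_Icusp x
  exact (hC x).subsingleton_continuousCohomology_two_of_isTorsion A hA τ

/-- **`cd_p(I_x) ≤ 1`** for a cuspidal inertia group `I_x ≅ Ẑ(1)`, every prime `p`.
[cite: MochizukiAbsTopIII2015, Prop 1.4 (i) p.31] -/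
theorem groupCdLE_one_Icusp (hC : InertiaFreeProcyclic C) (x : C.Cusp) (p : ℕ) [Fact p.Prime] :
    GroupCdLE (C.Icusp x) p 1 := by
  haveI := C.compactSpace_Icusp x
  exact (hC x).groupCdLE_one p

/-- **`#H¹(I_x, B) = #B^{I_x}`** for a cuspidal inertia group `I_x ≅ Ẑ(1)` and a finite discrete
`I_x`-module `B`. [cite: MochizukiAbsTopIII2015, Prop 1.4 (i) p.31] -/
theorem natCard_continuousCohomology_one_Icusp (hC : InertiaFreeProcyclic C) (x : C.Cusp)
    (B : Type u) [AddCommGroup B] [TopologicalSpace B] [DiscreteTopology B] [Finite B]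
    (τ : ContinuousRep (C.Icusp x) ℤ B) :
    Nat.card (continuousCohomology 1 τ.toTopRep) = Nat.card τ.toTopRep.ρ.invariants := by
  haveI := C.compactSpace_Icusp x
  exact (hC x).natCard_continuousCohomology_one_of_finite B τ

end FundamentalExtension.CuspidalData

end Literature.AnabelianGeometry.AbsoluteAnabelian

end
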